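import Summits.Langlands.Langlands.Theorems.IrreducibilityBySelfDualityPairLBoundaryJS
import Literature.NumberTheory.Automorphic.JPSSCornerWhittakerUnfolding
import Literature.NumberTheory.Automorphic.WhittakerTowerExpansion

/-!
# Inserting the Fourier–Whittaker expansion at depth `m` into the `GL_n × GL_m` integral:
`∫_G W_Φ(ι x) Θ(x) β_{N_m(K)}(x) dx = ∫_G Φ_m(ι x) Θ(x) β_{GL_m(K)}(x) dx`

Summit `Langlands`, sub-problem `Langlands`, helper file under `Theorems/` supporting the crux
`PairLBoundaryJS` (stmt-Langlands-13622), line `Sketch`, wave 3 (the projector road), registered stub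
`stub_gap_proj_whittaker_unfolding` (W4): the depth-`m` version, for GENERAL `0 < m < n`, of the tree's
`integral_whittakerDepth_glCorner_mul_eq` (`JPSSCornerWhittakerUnfolding`, the case `n = m + 1`). With
`ι = glCorner (m ≤ n) : x ↦ diag(x, 1_{n-m})`, `Φ` a cusp form on `GL_n(𝔸_K)`, `W_Φ = Φ_0 = whittakerDepth 0 Φ`
and `Φ_m = whittakerDepth m Φ` the partial Whittaker transform at depth `m` (Cogdell's projector `ℙⁿ_m`,
`WhittakerTower`), the Fourier–Whittaker expansion of `Φ_m` along `N_m(K)\GL_m(K)`,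

  `Φ_m(ι x) = Σ_{γ ∈ N_m(K)\GL_m(K)} W_Φ(ι(γ_𝔸 x))`   (`hasSum_whittakerDepth_of_summable`, Cogdell (2004),
  proof of Thm. 1.1, at depth `d = m` and the point `ι x`),

is inserted into `∫_G Φ_m(ι x) Θ(x) β(x) dν` and the sum is unfolded against the covering weights
(`integral_wt_smul_eq_integral_wt_smul_tsum`), exactly as in the corner case (Cogdell (2004), §2.2.1–2.2,
"since `ℙφ` is left invariant under `P_{m+1}(k)` … we may unfold"):

* `glCorner_glCorner_of_le`, `glCorner_mem_upperUnitriangular_iff_of_le`, `exists_cosetMap_glCorner` —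
  transitivity of corners `diag(diag(g, 1_{k-m}), 1_{n-k}) = diag(g, 1_{n-m})`, `diag(a, 1) ∈ N_n ↔ a ∈ N_m`,
  and the injective map of right-coset spaces `N_m(K)\GL_m(K) ↪ N_n(K)\GL_n(K)` induced by the corner;
* `summable_norm_whittakerDepth_glCorner_of_lt` — **absolute summability by restriction**: for a cusp form
  `Φ` on `GL_n(𝔸_K)`, `m < n` and every `x ∈ GL_n(𝔸_K)`, `Σ_{γ ∈ N_m(K)\GL_m(K)} ‖W_Φ(ι(γ_𝔸) x)‖ < ∞` (the
  sub-family, along `N_m(K)\GL_m(K) ↪ N_{n-1}(K)\GL_{n-1}(K)`, of the absolutely summable Whittaker series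
  `IsCuspFormGL.summable_norm_whittakerDepth_glCorner`);
* `integral_whittakerDepth_glCorner_mul_eq_depth` and the registered `∀`-closed
  `stub_gap_proj_whittaker_unfolding` (**main**) — for `0 < m < n`, a Haar measure `ν` on `GL_m(𝔸_K)`, a
  cusp form `Φ` on `GL_n(𝔸_K)`, `Θ` Borel and left `GL_m(K)`-invariant, a `GL_m(K)`-covering weight `β` and
  an `N_m(K)`-covering weight `β'`: if `∫ ‖W_Φ(ι x) Θ(x)‖ β'(x) dν < ∞` then

    `∫ W_Φ(ι x) Θ(x) β'(x) dν(x) = ∫ Φ_m(ι x) Θ(x) β(x) dν(x)`.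

## References

* J. W. Cogdell, *Analytic theory of L-functions for GL_n*, in *An Introduction to the Langlands
  Program* (2004), §1.1 Thm. 1.1, §2.2.1–2.2 (PDF pp. 176–177, 181–183) [CogdellAnalyticTheory2004].
* H. Jacquet, I. I. Piatetski-Shapiro, J. Shalika, *Rankin–Selberg convolutions*, Amer. J. Math. 105
  (1983), §2 [JacquetPiatetskiShapiroShalika1983].
-/

noncomputable section

-- `Summit.Langlands.Langlands.…` (summit = sub-problem name, D-0017 layout) trips `dupNamespace`
set_option linter.dupNamespace false

open scoped MatrixGroups Topology Pointwise ENNReal NNReal ComplexConjugate InnerProductSpace ContDiff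
-- the place subtypes indexing `mixedSpace K` are `Fintype` classically (`NormedCommRing (mixedSpace K)`)
open scoped Classical Matrix.Norms.Operator
open NumberField IsDedekindDomain MeasureTheory Measure Matrix Set Filter WithZero
open NumberField.mixedEmbedding
open Literature.NumberTheory.Automorphic AdelicGroupData
open Literature.NumberTheory.GaloisRepresentations (ideleGroup HeckeCharacter)
open Literature.MeasureTheory.Group
open Literature.RingTheory.SymmetricFunctions.SymmPoly
open ValuativeRel

-- the automorphic quotient carries the tree's Borel σ-algebra, not Mathlib's quotient σ-algebra
attribute [-instance] Quotient.instMeasurableSpace QuotientGroup.measurableSpace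

-- the house local instances, exactly as in `RankinSelbergUnfoldingIdentity`
attribute [local instance] adelicBorel borelSpace_adelic locallyCompactSpace_adelic secondCountableTopology_gl_adelic
  glAdeleBorel borelSpace_glAdele borelSpace_ideleGroup secondCountableTopology_ideleGroup

-- Mathlib idiom: the commutator Lie ring on matrices, to mention `(archGroupGL n K).lie`
attribute [local instance 100] LieRing.ofAssociativeRing

namespace Summit.Langlands.Langlands.Theorems.GapProjectedWhittakerUnfolding

/-! ### Corners of corners, and the coset map `N_m(K)\GL_m(K) ↪ N_n(K)\GL_n(K)` -/

section Corner

variable {m k n : ℕ}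

/-- **Transitivity of corner embeddings** (general form of `glCorner_glCorner`):
`diag(diag(g, 1_{k-m}), 1_{n-k}) = diag(g, 1_{n-m})` in `GL_n(R)` for `m ≤ k ≤ n`. [folklore] -/
theorem glCorner_glCorner_of_le {R : Type*} [CommRing R] (h₁ : m ≤ k) (h₂ : k ≤ n) (g : GL (Fin m) R) :
    glCorner R h₂ (glCorner R h₁ g) = glCorner R (h₁.trans h₂) g := by
  refine Units.ext (Matrix.ext fun i j => ?_)
  rw [glCorner_apply_val, glCorner_apply_val]
  by_cases hi : (i : ℕ) < k <;> by_cases hj : (j : ℕ) < k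
  · rw [dif_pos hi, dif_pos hj, glCorner_apply_val]
    simp only
    by_cases hi' : (i : ℕ) < m <;> by_cases hj' : (j : ℕ) < m
    · rw [dif_pos hi', dif_pos hj', dif_pos hi', dif_pos hj']
    · rw [dif_pos hi', dif_neg hj', dif_pos hi', dif_neg hj']
    · rw [dif_neg hi', if_pos hj', dif_neg hi', if_pos hj']
    · rw [dif_neg hi', if_neg hj', dif_neg hi', if_neg hj']
      by_cases hij : i = j
      · subst hij
        rw [if_pos rfl, if_pos rfl]
      · rw [if_neg (fun e => hij (Fin.ext (Fin.mk.inj_iff.1 e))), if_neg hij]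
  · rw [dif_pos hi, dif_neg hj]
    by_cases hi' : (i : ℕ) < m
    · rw [dif_pos hi', dif_neg (show ¬ ((j : ℕ) < m) by omega)]
    · rw [dif_neg hi', if_neg (show ¬ ((j : ℕ) < m) by omega), if_neg]
      intro e
      rw [e] at hi
      exact hj hi
  · rw [dif_neg hi, if_pos hj, dif_neg (show ¬ ((i : ℕ) < m) by omega)]
    by_cases hj' : (j : ℕ) < m
    · rw [if_pos hj']
    · rw [if_neg hj', if_neg]
      intro e
      rw [e] at hi
      exact hi hj
  · rw [dif_neg hi, if_neg hj, dif_neg (show ¬ ((i : ℕ) < m) by omega), if_neg (show ¬ ((j : ℕ) < m) by omega)]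

/-- **`diag(a, 1_{n-m}) ∈ N_n ↔ a ∈ N_m`** (general form of `glCorner_mem_upperUnitriangular_iff`): the corner
block of a unitriangular corner is unitriangular. [folklore] -/
theorem glCorner_mem_upperUnitriangular_iff_of_le {R : Type*} [CommRing R] (h : m ≤ n) (a : GL (Fin m) R) :
    glCorner R h a ∈ upperUnitriangular (Fin n) R ↔ a ∈ upperUnitriangular (Fin m) R := by
  refine ⟨fun ha => ?_, glCorner_mem_upperUnitriangular h⟩
  obtain ⟨ht, hdg⟩ := (mem_upperUnitriangular_iff _).1 ha
  rw [mem_upperUnitriangular_iff]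
  have hval : ∀ i j : Fin m, (a : Matrix (Fin m) (Fin m) R) i j =
      ((glCorner R h a : GL (Fin n) R) : Matrix (Fin n) (Fin n) R) ⟨i, by omega⟩ ⟨j, by omega⟩ := fun i j => by
    rw [glCorner_apply_val, dif_pos i.isLt, dif_pos j.isLt]
  refine ⟨fun i j hij => ?_, fun i => ?_⟩
  · rw [hval]
    exact ht (show id (⟨(j : ℕ), by omega⟩ : Fin n) < id ⟨(i : ℕ), by omega⟩ from Fin.mk_lt_mk.2 hij)
  · rw [hval]
    exact hdg _

variable {K : Type} [Field K]

/-- **The coset map `N_m(K)\GL_m(K) → N_n(K)\GL_n(K)` induced by the corner `γ ↦ diag(γ, 1)`** (`m ≤ n`) is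
well defined (`diag(N_m, 1) ⊆ N_n`) and injective (`diag(a, 1) ∈ N_n ↔ a ∈ N_m`), and Mathlib's representative
`Quotient.out` of the image coset differs from the corner of the representative of the coset by an element of
`N_n(K)` on the left. [folklore] -/
theorem exists_cosetMap_glCorner (h : m ≤ n) :
    ∃ ι : Quotient (QuotientGroup.rightRel (upperUnitriangular (Fin m) K)) →
        Quotient (QuotientGroup.rightRel (upperUnitriangular (Fin n) K)),
      Function.Injective ι ∧
        ∀ γ, (ι γ).out * (glCorner K h γ.out)⁻¹ ∈ upperUnitriangular (Fin n) K := by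
  refine ⟨Quotient.map' (glCorner K h) fun a b hab => ?_, ?_, ?_⟩
  · rw [QuotientGroup.rightRel_apply] at hab ⊢
    rw [← map_inv, ← map_mul]
    exact glCorner_mem_upperUnitriangular h hab
  · intro γ₁ γ₂ he
    induction γ₁ using Quotient.inductionOn with
    | h a =>
      induction γ₂ using Quotient.inductionOn with
      | h b =>
        have hab : glCorner K h b * (glCorner K h a)⁻¹ ∈ upperUnitriangular (Fin n) K :=
          QuotientGroup.rightRel_apply.1 (Quotient.exact he)
        rw [← map_inv, ← map_mul, glCorner_mem_upperUnitriangular_iff_of_le] at hab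
        exact Quotient.sound (QuotientGroup.rightRel_apply.2 hab)
  · intro γ
    induction γ using Quotient.inductionOn with
    | h a =>
      set c : GL (Fin n) K := glCorner K h a with hc
      set q : Quotient (QuotientGroup.rightRel (upperUnitriangular (Fin m) K)) := Quotient.mk _ a
      change (Quotient.mk (QuotientGroup.rightRel (upperUnitriangular (Fin n) K)) c).out * (glCorner K h q.out)⁻¹ ∈
        upperUnitriangular (Fin n) K
      have h1 : c * ((Quotient.mk (QuotientGroup.rightRel (upperUnitriangular (Fin n) K)) c).out)⁻¹ ∈
          upperUnitriangular (Fin n) K :=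
        QuotientGroup.rightRel_apply.1 (Quotient.mk_out (s := QuotientGroup.rightRel (upperUnitriangular (Fin n) K)) c)
      have h2 : a * q.out⁻¹ ∈ upperUnitriangular (Fin m) K :=
        QuotientGroup.rightRel_apply.1 (Quotient.mk_out (s := QuotientGroup.rightRel (upperUnitriangular (Fin m) K)) a)
      -- `out ⟦c⟧ · diag(out q, 1)⁻¹ = (c (out ⟦c⟧)⁻¹)⁻¹ · diag(a (out q)⁻¹, 1)`
      have e : (Quotient.mk (QuotientGroup.rightRel (upperUnitriangular (Fin n) K)) c).out * (glCorner K h q.out)⁻¹ =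
          (c * ((Quotient.mk (QuotientGroup.rightRel (upperUnitriangular (Fin n) K)) c).out)⁻¹)⁻¹ *
            glCorner K h (a * q.out⁻¹) := by
        rw [map_mul, map_inv, ← hc, _root_.mul_inv_rev, inv_inv, mul_assoc, inv_mul_cancel_left]
      rw [e]
      exact Subgroup.mul_mem _ (Subgroup.inv_mem _ h1) (glCorner_mem_upperUnitriangular h h2)

end Corner

/-! ### Absolute summability of the Whittaker series along `N_m(K)\GL_m(K)`, `m < n` -/

section Summable

variable {m n : ℕ} {K : Type} [Field K] [NumberField K]

local notation "𝔸" => AdeleRing (𝓞 K) K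

/-- **The Whittaker series of a cusp form on `GL_n(𝔸_K)` along the corner `N_m(K)\GL_m(K)` (`m < n`) is
absolutely summable at every point**: for a cusp form `Φ` on `GL_n(𝔸_K)` (`IsCuspFormGL`, standard compact
level structure), `m < n` and `x ∈ GL_n(𝔸_K)`, `Σ_{γ ∈ N_m(K)\GL_m(K)} ‖W_Φ(diag(γ_𝔸, 1_{n-m}) x)‖ < ∞`. Write
`n = n' + 1`; along the injective coset map `N_m(K)\GL_m(K) ↪ N_{n'}(K)\GL_{n'}(K)` of the corner
(`exists_cosetMap_glCorner`) the family is a sub-family of the absolutely summable Whittaker series of `Φ`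
over `N_{n'}(K)\GL_{n'}(K)` at `x` (`IsCuspFormGL.summable_norm_whittakerDepth_glCorner`, Cogdell (2004),
Thm. 1.1): the summand is a function of the coset (`whittakerDepth_zero_glCorner_ratGL_mul`) and
`diag(diag(γ, 1_{n'-m}), 1) = diag(γ, 1_{n-m})` (`glCorner_glCorner_of_le`). [cite: CogdellAnalyticTheory2004, Thm. 1.1] -/
theorem summable_norm_whittakerDepth_glCorner_of_lt {Φ : GL (Fin n) 𝔸 → ℂ}
    (hΦ : IsCuspFormGL n K (isCompact_glFiniteIntegralLevel_holds n K) Φ) (hmn : m < n) (x : GL (Fin n) 𝔸) :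
    Summable fun γ : Quotient (QuotientGroup.rightRel (upperUnitriangular (Fin m) K)) =>
      ‖whittakerDepth 0 Φ (glCorner 𝔸 hmn.le (ratGL K γ.out) * x)‖ := by
  obtain ⟨n', rfl⟩ : ∃ n', n = n' + 1 := ⟨n - 1, by omega⟩
  have hΦK : ∀ (δ : GL (Fin (n' + 1)) K) (y : GL (Fin (n' + 1)) 𝔸), Φ (ratGL K δ * y) = Φ y :=
    fun δ y => hΦ.1.leftInvariant _ (show _ ∈ rationalPointsGL (n' + 1) K from ⟨δ, rfl⟩) y
  have hm : m ≤ n' := Nat.lt_succ_iff.1 hmn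
  obtain ⟨ι, hι, hιN⟩ := exists_cosetMap_glCorner (K := K) hm
  have hS := hΦ.summable_norm_whittakerDepth_glCorner x
  refine (hS.comp_injective hι).congr fun γ => ?_
  simp only [Function.comp_apply]
  congr 1
  conv_lhs => rw [← inv_mul_cancel_right (ι γ).out (glCorner K hm γ.out),
    show ratGL K ((ι γ).out * (glCorner K hm γ.out)⁻¹ * glCorner K hm γ.out) =
      ratGL K ((ι γ).out * (glCorner K hm γ.out)⁻¹) * ratGL K (glCorner K hm γ.out) from map_mul _ _ _,
    map_mul, mul_assoc]
  rw [whittakerDepth_zero_glCorner_ratGL_mul hΦK (Nat.succ_pos n') (Nat.le_succ n') (hιN γ), ratGL_glCorner,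
    glCorner_glCorner_of_le]

end Summable

/-! ### Inserting the expansion of `Φ_m` and unfolding `GL_m(K) ⊇ N_m(K)` -/

section Unfold

variable {m n : ℕ} {K : Type} [Field K] [NumberField K]

local notation "𝔸" => AdeleRing (𝓞 K) K

/-- **Inserting the Fourier–Whittaker expansion at depth `m` and unfolding `GL_m(K) ⊇ N_m(K)`** (Cogdell
(2004), §2.2.1–2.2, general `m < n`). Let `m < n`, `ν` a Haar measure on `GL_m(𝔸_K)`, `Φ` a cusp form on
`GL_n(𝔸_K)` (`IsCuspFormGL`, standard compact level structure), `Θ : GL_m(𝔸_K) → ℂ` Borel and left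
`GL_m(K)`-invariant, `β` a Borel `GL_m(K)`-covering weight and `β'` a Borel `N_m(K)`-covering weight on
`GL_m(𝔸_K)` (covering sums `1`), `ι = glCorner (m ≤ n)`. If `∫ ‖W_Φ(ι x) Θ(x)‖ β'(x) dν < ∞`
(`W_Φ = whittakerDepth 0 Φ`), then with `Φ_m = whittakerDepth m Φ`

  `∫ W_Φ(ι x) Θ(x) β'(x) dν(x) = ∫ Φ_m(ι x) Θ(x) β(x) dν(x)`.

Proof: `F(x) = W_Φ(ι x) Θ(x)` is left `N_m(K)`-invariant (`whittakerDepth_zero_glCorner_ratGL_mul`); unfold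
`∫ F β' = ∫ β Σ_{γ ∈ N\GL_m(K)} F(γ_𝔸 ·)` (`integral_wt_smul_eq_integral_wt_smul_tsum` with the representatives
`γ.out`, `existsUnique_rightCoset_rep`), and `Σ_γ F(γ_𝔸 x) = Θ(x) Σ_γ W_Φ(ι(γ_𝔸) ι(x)) = Θ(x) Φ_m(ι x)` by
Cogdell's induction at depth `m` and the point `ι x` (`hasSum_whittakerDepth_of_summable`, its absolute
convergence `summable_norm_whittakerDepth_glCorner_of_lt`). For `n = m + 1` this is the tree's
`integral_whittakerDepth_glCorner_mul_eq` (`Φ_m = Φ`, `whittakerDepth_top`).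
[cite: CogdellAnalyticTheory2004, §2.2 (PDF pp. 181–183)] -/
theorem integral_whittakerDepth_glCorner_mul_eq_depth (hmn : m < n)
    (ν : Measure (GL (Fin m) 𝔸)) [IsHaarMeasure ν]
    {Φ : GL (Fin n) 𝔸 → ℂ} (hΦ : IsCuspFormGL n K (isCompact_glFiniteIntegralLevel_holds n K) Φ)
    {Θ : GL (Fin m) 𝔸 → ℂ} (hΘm : Measurable Θ)
    (hΘK : ∀ (γ₀ : GL (Fin m) K) (x : GL (Fin m) 𝔸), Θ (ratGL K γ₀ * x) = Θ x)
    {β β' : GL (Fin m) 𝔸 → ℝ≥0∞} (hβm : Measurable β)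
    (hβ : ∀ x, coveringSum ↥(ratPoints (⊤ : Subgroup (GL (Fin m) K))) β x = 1)
    (hβ'm : Measurable β') (hβ' : ∀ x, coveringSum ↥(ratPoints (tailUnipotent m K 0)) β' x = 1)
    (hint : ∫⁻ x, ‖whittakerDepth 0 Φ (glCorner 𝔸 hmn.le x) * Θ x‖ₑ * β' x ∂ν < ⊤) :
    ∫ x, whittakerDepth 0 Φ (glCorner 𝔸 hmn.le x) * Θ x * ((β' x).toReal : ℂ) ∂ν =
      ∫ x, whittakerDepth m Φ (glCorner 𝔸 hmn.le x) * Θ x * ((β x).toReal : ℂ) ∂ν := by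
  borelize (AdeleRing (𝓞 K) K)
  -- instances
  haveI : T2Space (GL (Fin m) 𝔸) := t2Space_gl m K
  haveI : SecondCountableTopology (GL (Fin m) 𝔸) := secondCountableTopology_generalLinearGroup_adeleRing K (Fin m)
  haveI : MeasurableMul₂ (GL (Fin m) 𝔸) := inferInstance
  haveI : Countable K := NumberField.countable' (K := K)
  haveI : Countable (Matrix (Fin m) (Fin m) K) := inferInstanceAs (Countable (Fin m → Fin m → K))
  haveI : Countable (GL (Fin m) K) :=
    Function.Injective.countable (f := fun g : GL (Fin m) K => (g : Matrix (Fin m) (Fin m) K)) fun _ _ h => Units.ext h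
  haveI : Countable ↥(ratPoints (⊤ : Subgroup (GL (Fin m) K))) :=
    Countable.of_equiv _ (ratPointsEquiv (⊤ : Subgroup (GL (Fin m) K))).toEquiv
  -- data of the cusp form
  have hn : 0 < n := by omega
  have hΦc : Continuous Φ := hΦ.1.continuous_gl
  have hΦK : ∀ (δ : GL (Fin n) K) (y : GL (Fin n) 𝔸), Φ (ratGL K δ * y) = Φ y :=
    fun δ y => hΦ.1.leftInvariant _ (show _ ∈ rationalPointsGL n K from ⟨δ, rfl⟩) y
  have hWc : Continuous (whittakerDepth 0 Φ) := continuous_whittakerDepth hΦc 0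
  have hιc : Continuous (glCorner 𝔸 hmn.le) := continuous_glCorner hmn.le
  -- the integrand `F = W(ι ·) Θ`
  set F : GL (Fin m) 𝔸 → ℂ := fun x => whittakerDepth 0 Φ (glCorner 𝔸 hmn.le x) * Θ x with hF
  have hFm : Measurable F := (hWc.comp hιc).measurable.mul hΘm
  have hFinv : ∀ γ ∈ ratPoints (tailUnipotent m K 0), ∀ x : GL (Fin m) 𝔸, F (γ • x) = F x := by
    intro γ hγ x
    obtain ⟨u, hu, rfl⟩ := (mem_ratPoints_iff _ _).1 hγ
    rw [tailUnipotent_zero] at hu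
    simp only [hF, smul_eq_mul, map_mul]
    rw [hΘK, whittakerDepth_zero_glCorner_ratGL_mul hΦK hn hmn.le hu]
  -- representatives
  set srep : Quotient (QuotientGroup.rightRel (upperUnitriangular (Fin m) K)) → GL (Fin m) 𝔸 :=
    fun γ => ratGL K γ.out with hsrep
  have hsΓ : ∀ γ, srep γ ∈ ratPoints (⊤ : Subgroup (GL (Fin m) K)) :=
    fun γ => (mem_ratPoints_iff _ _).2 ⟨γ.out, Subgroup.mem_top _, rfl⟩
  have hs : ∀ g ∈ ratPoints (⊤ : Subgroup (GL (Fin m) K)), ∃! γ, g * (srep γ)⁻¹ ∈ ratPoints (tailUnipotent m K 0) :=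
    fun g hg => existsUnique_rightCoset_rep g hg
  -- unfold
  have hle : ratPoints (tailUnipotent m K 0) ≤ ratPoints (⊤ : Subgroup (GL (Fin m) K)) := ratPoints_mono le_top
  have key := integral_wt_smul_eq_integral_wt_smul_tsum ν (ratPoints (⊤ : Subgroup (GL (Fin m) K)))
    (ratPoints (tailUnipotent m K 0)) hle hFm.stronglyMeasurable hFinv hβ'm hβ' hβm hβ hsΓ hs hint
  -- the Fourier–Whittaker expansion of `Φ_m` along the corner (Cogdell's induction at depth `m`)
  have hsum : ∀ x : GL (Fin m) 𝔸, ∑' γ, F (srep γ • x) = whittakerDepth m Φ (glCorner 𝔸 hmn.le x) * Θ x := by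
    intro x
    have hterm : ∀ γ : Quotient (QuotientGroup.rightRel (upperUnitriangular (Fin m) K)),
        F (srep γ • x) = whittakerDepth 0 Φ (glCorner 𝔸 hmn.le (ratGL K γ.out) *
          glCorner 𝔸 hmn.le x) * Θ x := by
      intro γ
      simp only [hF, hsrep, smul_eq_mul, map_mul, hΘK]
    simp_rw [hterm]
    rw [tsum_mul_right]
    congr 1
    have hS := summable_norm_whittakerDepth_glCorner_of_lt hΦ hmn (glCorner 𝔸 hmn.le x)
    have hFE := hasSum_whittakerDepth_of_summable hΦc hΦK hΦ.2 m hmn (glCorner 𝔸 hmn.le x) hS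
    exact hFE.tsum_eq
  -- assemble
  have h1 : ∀ x : GL (Fin m) 𝔸, wt β' x • F x =
      whittakerDepth 0 Φ (glCorner 𝔸 hmn.le x) * Θ x * ((β' x).toReal : ℂ) := fun x => by
    rw [wt, Complex.real_smul, hF]; ring
  have h2 : ∀ x : GL (Fin m) 𝔸, wt β x • (∑' γ, F (srep γ • x)) =
      whittakerDepth m Φ (glCorner 𝔸 hmn.le x) * Θ x * ((β x).toReal : ℂ) := fun x => by
    rw [hsum x, wt, Complex.real_smul]; ring
  simp_rw [h1, h2] at key
  exact key

end Unfold

/-! ### The registered stub -/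

/-- **STUB (W4) — the Fourier–Whittaker unfolding at depth `m` for the projected `GL_n × GL_m` integral**
(Cogdell (2004), §2.2.1–2.2): the registered `∀`-closed signature, by
`integral_whittakerDepth_glCorner_mul_eq_depth` (the hypothesis `0 < m` of the projector road is not used
by this step). [cite: CogdellAnalyticTheory2004, §2.2 (PDF pp. 181–183)] -/
theorem stub_gap_proj_whittaker_unfolding :
    ∀ {n m : ℕ} {K : Type} [Field K] [NumberField K] (_hm : 0 < m) (hmn : m < n)
      (ν : Measure (GL (Fin m) (AdeleRing (𝓞 K) K))) [IsHaarMeasure ν]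
      {Φ : GL (Fin n) (AdeleRing (𝓞 K) K) → ℂ},
      IsCuspFormGL n K (isCompact_glFiniteIntegralLevel_holds n K) Φ →
      ∀ {Θ : GL (Fin m) (AdeleRing (𝓞 K) K) → ℂ}, Measurable Θ →
      (∀ (γ₀ : GL (Fin m) K) (x : GL (Fin m) (AdeleRing (𝓞 K) K)), Θ (ratGL K γ₀ * x) = Θ x) →
      ∀ {β β' : GL (Fin m) (AdeleRing (𝓞 K) K) → ℝ≥0∞}, Measurable β →
      (∀ x, coveringSum ↥(ratPoints (⊤ : Subgroup (GL (Fin m) K))) β x = 1) →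
      Measurable β' → (∀ x, coveringSum ↥(ratPoints (tailUnipotent m K 0)) β' x = 1) →
      ∫⁻ x, ‖whittakerDepth 0 Φ (glCorner (AdeleRing (𝓞 K) K) hmn.le x) * Θ x‖ₑ * β' x ∂ν < ⊤ →
      ∫ x, whittakerDepth 0 Φ (glCorner (AdeleRing (𝓞 K) K) hmn.le x) * Θ x * ((β' x).toReal : ℂ) ∂ν =
        ∫ x, whittakerDepth m Φ (glCorner (AdeleRing (𝓞 K) K) hmn.le x) * Θ x * ((β x).toReal : ℂ) ∂ν := by
  intro n m K _ _ _ hmn ν _ Φ hΦ Θ hΘm hΘK β β' hβm hβ hβ'm hβ'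
  exact integral_whittakerDepth_glCorner_mul_eq_depth hmn ν hΦ hΘm hΘK hβm hβ hβ'm hβ'


end Summit.Langlands.Langlands.Theorems.GapProjectedWhittakerUnfolding

end
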